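import Summits.BirchSwinnertonDyer.BirchSwinnertonDyer.Theorems.SignedBaseChangeAnticyclotomicEisensteinDivisibilityAdmdefUnitLambdaOfHeegnerRoot
import Summits.BirchSwinnertonDyer.BirchSwinnertonDyer.Theorems.SignedBaseChangeAnticyclotomicEisensteinDivisibilityFrameConcordance
import Summits.BirchSwinnertonDyer.Rank1Residual.X11b.UnrSeriesIdealEqualityDescent
import Literature.NumberTheory.EllipticCurves.AnticyclotomicSignedTransferInputs
import Literature.NumberTheory.EllipticCurves.BurungaleKobayashiNakamuraOta2026.LocalBottomIndex
import Literature.NumberTheory.EllipticCurves.CastellaGrossiSkinner2025.GreenbergAnticyclotomicMainConjectureProofs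
import Literature.NumberTheory.EllipticCurves.UnrIntegersUnits
import Summits.BirchSwinnertonDyer.Rank1Residual.X11b.FramePrincipalUnitPowers
import HarnessLib

/-!
# Line `admdef` on the crux `AnticyclotomicEisensteinDivisibility` (stmt-BirchSwinnertonDyer-20727), LEAD gen 24:
# the `+` signed HEEGNER class of the bridge is `p`-PRIMITIVE in `Sel_+(K, 𝐓^ac)`, and its bottom layer vanishes
# iff the conductor-`p` norm Heegner point `z_0 = N_{K[p]/K} P[p]` lies in `p·E(K)`

Lead seat bsd-line-sbc-p1 (gen 24), `--supports stmt-BirchSwinnertonDyer-20727`.  Two kernel facts behind the v22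
re-key of the core-root research stub of `Lines/admdef.lean` (v21: `stub_rootVisibleRankOneZ`, «on cell β, if
`Sel_p(E/K)[p]` is a line then no analytically pinned `+` tuple has bottom class `z_{0,1} = 0`») into HEEGNER-POINT
currency («… then the `p`-primitive `+` signed Heegner class has `z_{0,1} ≠ 0`» = Kolyvagin's conjecture mod `p` at
the bottom of the anticyclotomic tower, Selmer corank one, good supersingular `p`):

* §1 `layer_zero_one_eq_zero_iff_exists_smul_eq` — for `z` the `+`-signed `Λ^ac`-adic Heegner class of a Heegner family
  `F` (`AcSigned.IsSignedHeegnerClass p κ γ F 1 z`, Castella–Wan Prop. 4.4 / Def. 4.5 as typed): `z_{0,1} = 0` in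
  `H¹(K, E[p])` iff the norm point `z_0 = F.z 0 = N_{K[p]/K} P[p]` is `p • R` for a `Γ_K`-fixed `R ∈ E(K̄)`, i.e. lies
  in `p·E(K)` (LEAD gen 19's `layer_zero_eq_kummerClass_of_isSignedHeegnerClass_one` + Kummer injectivity
  `kummerClassOver_eq_zero_iff` + divisibility of `E(K̄)`; `Gal(K̄/K_0) = Γ_K`).
* §2 `mem_span_C_sq_of_transferInputs_of_eq_smul` — Castella–Wan's explicit reciprocity law in IDEAL form (the field
  `signedLog_erl` of `AcSigned.TransferInputs … ε z L`: `(L) = ι_Λ((Log loc_𝔭 z)²)·R₀⟦T⟧`) forces `L ∈ (p²)` as soon as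
  `z = p • z''` in `Sel_ε(K, 𝐓^ac)` (`loc_𝔭`, `Log` additive; `ι_Λ` fixes constants).
* §2 **`ne_smul_of_transferInputs_of_isUnit_coeff`** — hence, if SOME Castella-normalised BDP frame `L_C`
  (`IsBDPLFunction`, same `(ι, 𝔭, κ, γ, f)`) has `μ = 0` (a unit coefficient: Burungale–Castella–Skinner 2025
  Prop. 4.2.2 ∕ Hsieh 2014 Thm. B, the line's cite conjunct (7)), the transfer class is `p`-PRIMITIVE: `z ≠ p • z''` for
  every `z''`.  Route: frame concordance `(L_W)·𝒪_{ℂ_p}⟦T⟧ = (L_C)·𝒪_{ℂ_p}⟦T⟧` (width seat w2, p634869) ⟶ equality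
  descent to `R₀⟦T⟧` (cell b2b-bsdres X11b `ideal_eq_span_singleton_of_map_eq_span`) ⟶ `L_C ∈ (L_W) ⊆ (p²)` ⟶ a unit
  coefficient of `L_C` would make `p` a unit of `R₀`, but `‖p‖ = p⁻¹ < 1` (`unrIntegers.isUnit_iff_norm_eq_one`).

No definition, no named fact, no `sorry`; standard axioms.  Nothing about any curve is asserted unconditionally; BSD / the
crux / Kolyvagin's conjecture are NOT proved by this file.

## References
* [CastellaWan2023] F. Castella, X. Wan, Math. Ann. 389 (2024): Prop. 4.4, Def. 4.5 (MS pp. 20–22), Def. 6.1, Thm. 6.2,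
  proof of Thm. 6.8 (MS pp. 25–31), Prop. 2.1 (MS p. 6).
* [BurungaleCastellaSkinner2025] Prop. 4.2.2 (arXiv:2405.00270v2 §4.2); [Hsieh2014] Thm. B.
* [Castella2018] Thm. 3.1 (the frame `IsBDPLFunction`), §3 (`R₀ ⊂ 𝒪_{ℂ_p}`).
* [SilvermanAEC2009] VIII.§2 (Kummer sequence); [GrossLMS1991] §2.
-/

-- D-0017: single-problem summit, the namespace repeats the problem name by design.
set_option linter.dupNamespace false
set_option autoImplicit false

noncomputable section

open scoped Classical

open PowerSeries NumberField IsDedekindDomain Field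
open Literature.NumberTheory.EllipticCurves Literature.NumberTheory.GaloisRepresentations
open Literature.NumberTheory.EllipticCurves.AcSigned Literature.NumberTheory.EllipticCurves.CastellaWan2024
open WeierstrassCurve (geomTorsion geomPoints)
open Summit.BirchSwinnertonDyer.BirchSwinnertonDyer.Theorems.SignedBaseChangeAcDivAdmdefUnitLambdaOfHeegnerRoot

namespace Summit.BirchSwinnertonDyer.BirchSwinnertonDyer.Theorems.SignedBaseChangeAcDivAdmdefHeegnerPrimitive

/-! ## §1 The bottom dictionary: `z_{0,1} = 0 ⟺ z_0 ∈ p·E(K)` -/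

section Bottom

variable {K : Type} [Field K] [NumberField K] {N : ℕ} [NeZero N] {W : WeierstrassCurve ℚ} [W.IsElliptic]
  {p : ℕ} [Fact p.Prime] {κ : ZpExtension K p} {γ : absoluteGaloisGroup K} {jbar : AlgebraicClosure K →+* ℂ}

/-- **The bottom layer of the `+` signed Heegner class vanishes iff `z_0 ∈ p·E(K)`.**  For `z` the `+`-signed
`Λ^ac`-adic Heegner class of the family `F` (`IsSignedHeegnerClass p κ γ F 1 z`), the component
`z_{0,1} ∈ H¹(Gal(K̄/K_0), E[p]) = H¹(K, E[p])` is `0` iff the norm point `z_0 = F.z 0 = N_{K[p]/K_0} P[p]` is `p • R`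
for some `R ∈ E(K̄)` fixed by `Γ_K` (i.e. `z_0 ∈ p·E(K)`): at layer `0` the class IS the Kummer class `δ_K(z_0)`
(`layer_zero_eq_kummerClass_of_isSignedHeegnerClass_one`, Prop. 4.4 with `n = 0`), and the Kummer map is injective
modulo `p·E(K)` (AEC VIII.§2). [cite: CastellaWan2023, Prop. 4.4, Def. 4.5 (MS pp. 20–22)] [cite: SilvermanAEC2009, VIII.§2, Prop. 2.1 setting] -/
theorem layer_zero_one_eq_zero_iff_exists_smul_eq {F : HeegnerFamily N W K κ jbar}
    {z : Π n m : ℕ, (W.baseChange K).torsionH1Over ((p : ℤ) ^ m) (κ.layerSubgroup n)}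
    (hz : IsSignedHeegnerClass p κ γ F 1 z) :
    z 0 1 = 0 ↔ ∃ R : geomPoints (W.baseChange K), (∀ σ : absoluteGaloisGroup K, σ • R = R) ∧ (p : ℤ) • R = F.z 0 := by
  have hp0 : ((p : ℤ) ^ 1) ≠ 0 := pow_ne_zero _ (Int.natCast_ne_zero.mpr (Fact.out : p.Prime).ne_zero)
  obtain ⟨Q, hQ⟩ := (W.baseChange K).zsmul_geomPoints_surjective_holds hp0 (F.z 0)
  rw [layer_zero_eq_kummerClass_of_isSignedHeegnerClass_one hz one_pos Q hQ,
    (W.baseChange K).kummerClassOver_eq_zero_iff (κ.layerSubgroup 0) ((p : ℤ) ^ 1) Q _]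
  simp only [pow_one, ZpExtension.layerSubgroup_zero, Subgroup.mem_top, forall_const] at hQ ⊢
  constructor
  · rintro ⟨R, hRfix, hR⟩
    exact ⟨R, hRfix, hR.trans hQ⟩
  · rintro ⟨R, hRfix, hR⟩
    exact ⟨R, hRfix, hR.trans hQ.symm⟩

/-- **Contrapositive reading used by the line**: if `z_0 ∉ p·E(K)` then `z_{0,1} ≠ 0`. [cite: CastellaWan2023, Prop. 4.4 (MS p. 20)] -/
theorem layer_zero_one_ne_zero_of_not_exists_smul_eq {F : HeegnerFamily N W K κ jbar}
    {z : Π n m : ℕ, (W.baseChange K).torsionH1Over ((p : ℤ) ^ m) (κ.layerSubgroup n)}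
    (hz : IsSignedHeegnerClass p κ γ F 1 z)
    (h : ¬ ∃ R : geomPoints (W.baseChange K), (∀ σ : absoluteGaloisGroup K, σ • R = R) ∧ (p : ℤ) • R = F.z 0) :
    z 0 1 ≠ 0 :=
  fun h0 ↦ h ((layer_zero_one_eq_zero_iff_exists_smul_eq hz).mp h0)

end Bottom

/-! ## §2 `p`-primitivity of a transfer class from `μ(L_p^BDP) = 0` -/

section Primitive

variable {K : Type} [Field K] [NumberField K] {W : WeierstrassCurve ℚ} {p : ℕ} [Fact p.Prime]
  {κ : ZpExtension K p} {γ : absoluteGaloisGroup K} {hγ : κ.IsTopGenerator γ}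
  {𝔭 : HeightOneSpectrum (𝓞 K)} {h𝔭 : IsNonsplitIn κ 𝔭} {γ𝔭 : absoluteGaloisGroup (𝔭.adicCompletion K)}
  {hγ𝔭 : κ (resGalOfEmb (closureEmb (K := K) (𝔭.adicCompletion K)) γ𝔭) = κ γ}
  {𝔭' : HeightOneSpectrum (𝓞 K)} {h𝔭𝔭' : 𝔭 ≠ 𝔭'} {h𝔭p : ((p : ℕ) : 𝓞 K) ∈ 𝔭.asIdeal} {ε : ℤˣ}
  {z : selmerLambdaAdic (W.baseChange K) p κ γ (fun _ ↦ .sgn ε)} {L : UnrSeries p}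

/-- **The ideal ERL forces `p² ∣ L` when the class is `p`-divisible.**  If `z = p • z''` in `Sel_ε(K, 𝐓^ac)`, then
`loc_𝔭 z = p • loc_𝔭 z''`, `Log(loc_𝔭 z) = p · Log(loc_𝔭 z'')`, and Castella–Wan's Thm. 6.2 in ideal form
(`TransferInputs.signedLog_erl`: `(L) = ι_Λ((Log loc_𝔭 z)²)·R₀⟦T⟧` along the structure map `j : ℤ_p → R₀`) gives
`L ∈ (p²)·R₀⟦T⟧`. [cite: CastellaWan2023, Def. 6.1, Thm. 6.2 (MS pp. 25–26), proof of Thm. 6.8 (6.14)] -/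
theorem mem_span_C_sq_of_transferInputs_of_eq_smul
    (h : TransferInputs (W.baseChange K) p κ γ hγ 𝔭 h𝔭 γ𝔭 hγ𝔭 𝔭' h𝔭𝔭' h𝔭p ε z L)
    {z'' : selmerLambdaAdic (W.baseChange K) p κ γ (fun _ ↦ .sgn ε)} (hz : z = p • z'') :
    L ∈ Ideal.span {(PowerSeries.C ((p : unrIntegers p) ^ 2) : UnrSeries p)} := by
  obtain ⟨Log, _hLog, hL⟩ := h.signedLog_erl
  obtain ⟨j, hj⟩ := exists_ringHom_padicInt_unrIntegers p
  have e := hL j hj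
  set lz'' := locSignedAt (W.baseChange K) p κ 𝔭 h𝔭 γ γ𝔭 hγ𝔭 (fun _ ↦ .sgn ε) ε rfl h𝔭p z'' with hlz''
  have hloc : locSignedAt (W.baseChange K) p κ 𝔭 h𝔭 γ γ𝔭 hγ𝔭 (fun _ ↦ .sgn ε) ε rfl h𝔭p z = p • lz'' := by
    rw [hz, map_nsmul]
  have hLog : Log (locSignedAt (W.baseChange K) p κ 𝔭 h𝔭 γ γ𝔭 hγ𝔭 (fun _ ↦ .sgn ε) ε rfl h𝔭p z) =
      (p : IwasawaAlgebra p) * Log lz'' := by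
    rw [hloc, map_nsmul, nsmul_eq_mul]
  have hsq : IwasawaAlgebra.invol p
        (Log (locSignedAt (W.baseChange K) p κ 𝔭 h𝔭 γ γ𝔭 hγ𝔭 (fun _ ↦ .sgn ε) ε rfl h𝔭p z) ^ 2) =
      (p : IwasawaAlgebra p) ^ 2 * IwasawaAlgebra.invol p (Log lz'' ^ 2) := by
    rw [hLog, mul_pow, map_mul, map_pow, map_natCast]
  rw [hsq, Ideal.map_span, Set.image_singleton, map_mul, map_pow, map_natCast] at e
  have hmem : L ∈ Ideal.span {L} := Ideal.mem_span_singleton_self L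
  rw [e] at hmem
  obtain ⟨c, hc⟩ := Ideal.mem_span_singleton'.mp hmem
  refine Ideal.mem_span_singleton'.mpr ⟨c * PowerSeries.map j (IwasawaAlgebra.invol p (Log lz'' ^ 2)), ?_⟩
  rw [← hc]
  simp only [map_pow, map_natCast]
  ring

/-- `p` is not a unit of `R₀ = 𝒪(\widehat{ℚ_p^ur})`: `‖p‖ = p⁻¹ < 1` while units have norm `1`.
[cite: Castella2018, §3 (p. 9)] -/
theorem not_isUnit_natCast_unrIntegers : ¬ IsUnit ((p : ℕ) : unrIntegers p) := by
  intro hu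
  have h1 := (unrIntegers.isUnit_iff_norm_eq_one _).mp hu
  have hcoe : (((p : ℕ) : unrIntegers p) : ℂ_[p]) = ((p : ℕ) : ℂ_[p]) := by simp
  rw [hcoe, Summit.BirchSwinnertonDyer.Rank1Residual.X11b.R1.norm_natCast_padicComplex] at h1
  have hlt : ‖((p : ℕ) : ℚ_[p])‖ < 1 := Padic.norm_p_lt_one
  exact absurd h1 hlt.ne

/-- **`p`-PRIMITIVITY OF THE TRANSFER CLASS from `μ(L_p^BDP) = 0`.**  On the frame of the line (`p` odd, `K` imaginary
quadratic, `κ` anticyclotomic with topological generator `γ`, `p ∤ N`, `p ∤ D_K`): if `(Ω_K, Ω_p, L)` is a Castella–Wan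
BDP frame (`IsCWBDPLFunction`, Prop. 2.1) carrying the transfer inputs of the proof of CW24 Thm. 6.8 for the class
`z ∈ Sel_ε(K, 𝐓^ac)` (`TransferInputs … ε z L`), and `(Ω_K', Ω_p', L_C)` is ANY Castella-normalised BDP frame
(`IsBDPLFunction`, Thm. 3.1) for the same `(ι, 𝔭, κ, γ, f)` with `μ(L_C) = 0` (some coefficient a unit of `R₀` —
BCS25 Prop. 4.2.2 ∕ Hsieh Thm. B), then `z` is NOT divisible by `p` in `Sel_ε(K, 𝐓^ac)`.  Proof: the two frames
generate the same ideal of `𝒪_{ℂ_p}⟦T⟧` (frame concordance), hence of `R₀⟦T⟧` (equality descent), so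
`L_C ∈ (L)`; a `p`-divisible class gives `L ∈ (p²)`; a unit coefficient of `L_C ∈ (p²)` makes `p` a unit of `R₀`.
[cite: CastellaWan2023, Thm. 6.2, Cor. 6.4, proof of Thm. 6.8 (MS pp. 26–31), Prop. 2.1 (MS p. 6)]
[cite: BurungaleCastellaSkinner2025, Prop. 4.2.2 (arXiv:2405.00270v2 §4.2)] [cite: Hsieh2014, Thm. B] [cite: Castella2018, Thm. 3.1] -/
theorem ne_smul_of_transferInputs_of_isUnit_coeff {N : ℕ} {ι : PadicAlgCl p ≃+* ℂ}
    {f : CuspForm (CongruenceSubgroup.Gamma0 N) 2} {ΩK ΩK' : ℂ} {Ωp Ωp' : (unrIntegers p)ˣ} {LC : UnrSeries p}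
    (hp2 : p ≠ 2) (hK : IsImaginaryQuadratic K) (hκa : κ.IsAnticyclotomic) (hpN : ¬ p ∣ N)
    (hpD : ¬ (p : ℤ) ∣ NumberField.discr K) (hΩK : ΩK ≠ 0) (hΩK' : ΩK' ≠ 0)
    (hW : IsCWBDPLFunction ι 𝔭 κ γ f (NumberField.discr K) ΩK ((Ωp : unrIntegers p) : ℂ_[p]) L)
    (hC : IsBDPLFunction ι 𝔭 κ γ f ΩK' ((Ωp' : unrIntegers p) : ℂ_[p]) LC)
    (hμ : ∃ k : ℕ, IsUnit (PowerSeries.coeff k LC))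
    (h : TransferInputs (W.baseChange K) p κ γ hγ 𝔭 h𝔭 γ𝔭 hγ𝔭 𝔭' h𝔭𝔭' h𝔭p ε z L)
    (z'' : selmerLambdaAdic (W.baseChange K) p κ γ (fun _ ↦ .sgn ε)) : z ≠ p • z'' := by
  intro hz
  -- `L ∈ (p²)` from the ideal ERL
  have hL : L ∈ Ideal.span {(PowerSeries.C ((p : unrIntegers p) ^ 2) : UnrSeries p)} :=
    mem_span_C_sq_of_transferInputs_of_eq_smul h hz
  -- the two frames generate the same ideal of `𝒪_{ℂ_p}⟦T⟧`, hence of `R₀⟦T⟧`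
  have hconc : Ideal.span {PowerSeries.map (Summit.BirchSwinnertonDyer.Rank1Residual.X11b.R1.unrToCpInt p) L} =
      Ideal.span {PowerSeries.map (Summit.BirchSwinnertonDyer.Rank1Residual.X11b.R1.unrToCpInt p) LC} :=
    SignedBaseChangeAcDivFrameConcordance.span_map_eq_of_isCWBDPLFunction_of_isBDPLFunction hp2 hK hκa hγ hpN hpD
      hΩK hΩK' (coe_units_unrIntegers_ne_zero' Ωp) (coe_units_unrIntegers_ne_zero' Ωp') hW hC
  have hdesc : Ideal.span {LC} = Ideal.span {L} :=
    Summit.BirchSwinnertonDyer.Rank1Residual.X11b.ideal_eq_span_singleton_of_map_eq_span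
      (by rw [Ideal.map_span, Set.image_singleton, hconc])
  have hLC : LC ∈ Ideal.span {(PowerSeries.C ((p : unrIntegers p) ^ 2) : UnrSeries p)} := by
    have h1 : LC ∈ Ideal.span {L} := hdesc ▸ Ideal.mem_span_singleton_self LC
    exact (Ideal.span_singleton_le_iff_mem _).mpr hL h1
  -- a unit coefficient of `LC = C(p²)·M` makes `p` a unit of `R₀`
  obtain ⟨M, hM⟩ := Ideal.mem_span_singleton'.mp hLC
  obtain ⟨k, hk⟩ := hμ
  rw [← hM, mul_comm, PowerSeries.coeff_C_mul] at hk
  have hp_unit : IsUnit ((p : ℕ) : unrIntegers p) :=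
    (isUnit_pow_iff two_ne_zero).mp (isUnit_of_mul_isUnit_left hk)
  exact not_isUnit_natCast_unrIntegers hp_unit
where
  /-- A unit of `R₀` is non-zero in `ℂ_p`. [folklore] -/
  coe_units_unrIntegers_ne_zero' (u : (unrIntegers p)ˣ) : ((u : unrIntegers p) : ℂ_[p]) ≠ 0 := by
    intro h0
    have : (u : unrIntegers p) = 0 := Subtype.ext h0
    exact u.ne_zero this

end Primitive

end Summit.BirchSwinnertonDyer.BirchSwinnertonDyer.Theorems.SignedBaseChangeAcDivAdmdefHeegnerPrimitive

end
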